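import Summits.BirchSwinnertonDyer.BirchSwinnertonDyer.Theses.BiquadraticEisensteinDescent
import Literature.NumberTheory.EllipticCurves.KrizLi2019.SexticTwistAnalyticRank
import Literature.NumberTheory.EllipticCurves.QuadraticTwist
import Literature.NumberTheory.EllipticCurves.AnalyticRankOrderProofs
import Literature.NumberTheory.QuadraticFields.ReducedForms
import HarnessLib

set_option linter.dupNamespace false
set_option autoImplicit false

/-!
# Sketch (crux-ideate seat 1, g6, round 1) — first lemma of the crux idea
# `sextic-eisenstein-density-switch` for `HeegnerTwistCouplingInSupply` (stmt-BirchSwinnertonDyer-21381)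

The SEXTIC SUB-CORNER of the CM-inert bad-prime corner: `W ≅_ℚ E_d : y² = x³ − 432 d`
(`j = 0`, CM by `ℤ[ζ₃]`), `d` a fundamental discriminant with `d < 0, d ≡ 2 (mod 9)` or
`d > 0, d ≡ 3, 5, 8 (mod 9)` (the rank-one residue classes of Kriz–Li, FMS 7 (2019) Cor. 10.7 (2)),
the fixed `3`-class-number condition `h₃(d) = 1` (`d < 0`) / `h₃(−3d) = 1` (`d > 0`), and the corner
prime `p ≥ 5`, `p ∣ d` (so `p` is additive for `W`; `CMInert W p` iff `p ≡ 2 (mod 3)`).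

On this sub-corner the `L`-conjunct of the crux is SWITCHED, via the typed fact
`KrizLi2019.cor107_analyticRank_sexticTwist` (Heegner-point formal logarithm is a `3`-adic unit
⟸ two `3`-class numbers are trivial), into a Davenport–Heilbronn event: the crux restricted to the
sub-corner follows from the purely class-group statement `JointSupplyP3` (a Heegner field `K'` for
`N_W` with `p ∤ h_{K'}` AND `3 ∤ h(ℚ(√(d₀·d_{K'})))`, `d₀ = d` (`d>0`) / `−3d` (`d<0`)).
The transfer `cruxOnSexticCorner_of_jointSupply` is PROVED below (kernel-checked plumbing); the two
literature inputs enter as hypotheses BY NAME (`cor107_analyticRank_sexticTwist`,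
`hasEntireLFunction_rat`) and `JointSupplyP3` is the open residual `C⁺`.
Nothing about BSD is proved here.
-/

namespace Summit.BirchSwinnertonDyer.BirchSwinnertonDyer.Cruxes.HeegnerTwistCouplingInSupply.SexticSwitch

open WeierstrassCurve NumberField Literature.NumberTheory.EllipticCurves
  Literature.NumberTheory.EllipticCurves.KrizLi2019
  Literature.NumberTheory.EllipticCurves.Rank1Residual

/-- The Kriz–Li sextic rank-one datum for `W`: `W ≅_ℚ E_d`, `d` fundamental, the Cor. 10.7 (2)
residue classes, and the `W`-only half of hypothesis (3) of Thm. 10.6. -/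
def IsKrizLiSexticRankOne (W : WeierstrassCurve ℚ) (d : ℤ) : Prop :=
  (∃ C : VariableChange ℚ, C • W = ({ a₁ := 0, a₂ := 0, a₃ := 0, a₄ := 0, a₆ := -432 * d } :
      WeierstrassCurve ℚ)) ∧
  ((d % 4 = 1 ∧ Squarefree d ∧ d ≠ 1) ∨
      (4 ∣ d ∧ (d / 4 % 4 = 2 ∨ d / 4 % 4 = 3) ∧ Squarefree (d / 4))) ∧
  (d < 0 ∧ d % 9 = 2 ∨ 0 < d ∧ (d % 9 = 3 ∨ d % 9 = 5 ∨ d % 9 = 8)) ∧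
  (0 < d → ThreeClassNumberTrivial (-3 * d)) ∧ (d < 0 → ThreeClassNumberTrivial d)

/-- `C⁺` — the (p,3) JOINT CLASS-NUMBER SUPPLY on the sextic sub-corner (the open residual of the
line; no `L`-function, no elliptic curve beyond the level `N_W` and the datum `d`): given the
route's cofinal `p`-indivisible Heegner supply, SOME Heegner field `K'` for `N_W` (and for `3|d|`)
with `|d_{K'}| > 4` has `p ∤ h_{K'}` and `3 ∤ h(ℚ(√(d₀ d_{K'})))`. -/
def JointSupplyP3 : Prop :=
  ∀ (W : WeierstrassCurve ℚ) [W.IsElliptic] [W.IsGloballyMinimal] (p : ℕ) [Fact p.Prime]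
    [NeZero (W.conductorNorm ℤ)] (d : ℤ),
    IsKrizLiSexticRankOne W d → 5 ≤ p → (p : ℤ) ∣ d → CMInert W p →
    (∀ B : ℕ, ∃ (K : Type) (_ : Field K) (_ : NumberField K),
        IsImaginaryQuadratic K ∧ B < (NumberField.discr K).natAbs ∧
          4 < (NumberField.discr K).natAbs ∧
          SatisfiesHeegnerHypothesis (W.conductorNorm ℤ) K ∧ ¬ p ∣ NumberField.classNumber K) →
    ∃ (K : Type) (_ : Field K) (_ : NumberField K),
      IsImaginaryQuadratic K ∧ 4 < (NumberField.discr K).natAbs ∧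
        SatisfiesHeegnerHypothesis (W.conductorNorm ℤ) K ∧
        SatisfiesHeegnerHypothesis (3 * d.natAbs) K ∧
        ¬ p ∣ NumberField.classNumber K ∧
        (0 < d → ThreeClassNumberTrivial (NumberField.discr K * d)) ∧
        (d < 0 → ThreeClassNumberTrivial (-3 * NumberField.discr K * d))

/-- The crux `HeegnerTwistCouplingInSupply` RESTRICTED to the sextic sub-corner (same binders and
conclusion as the route decl, plus the datum `d` with `IsKrizLiSexticRankOne W d` and `p ∣ d`). -/
def CruxOnSexticCorner : Prop :=
  ∀ (W : WeierstrassCurve ℚ) [W.IsElliptic] [W.IsGloballyMinimal] (p : ℕ) [Fact p.Prime]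
    [NeZero (W.conductorNorm ℤ)] (d : ℤ),
    IsKrizLiSexticRankOne W d → (p : ℤ) ∣ d →
    W.HasCM → W.analyticRank = 1 → 5 ≤ p → CMInert W p → ¬ Good W p →
    (∀ B : ℕ, ∃ (K : Type) (_ : Field K) (_ : NumberField K),
        IsImaginaryQuadratic K ∧ B < (NumberField.discr K).natAbs ∧
          4 < (NumberField.discr K).natAbs ∧
          SatisfiesHeegnerHypothesis (W.conductorNorm ℤ) K ∧ ¬ p ∣ NumberField.classNumber K) →
    ∃ (K : Type) (_ : Field K) (_ : NumberField K),
      IsImaginaryQuadratic K ∧ 4 < (NumberField.discr K).natAbs ∧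
        SatisfiesHeegnerHypothesis (W.conductorNorm ℤ) K ∧
        (W.quadraticTwist (NumberField.discr K : ℚ)).entireLFunction 1 ≠ 0 ∧
        ¬ p ∣ NumberField.classNumber K

/-- Residue bookkeeping: the Cor. 10.7 (2) classes imply hypothesis (2) of Thm. 10.6. -/
theorem mod3_of_case {d : ℤ}
    (h : d < 0 ∧ d % 9 = 2 ∨ 0 < d ∧ (d % 9 = 3 ∨ d % 9 = 5 ∨ d % 9 = 8)) :
    d % 3 = 2 ∨ d % 9 = 3 := by
  have h93 : d % 9 % 3 = d % 3 := Int.emod_emod_of_dvd d (by norm_num)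
  rcases h with ⟨-, h9⟩ | ⟨-, h9 | h9 | h9⟩
  · left; omega
  · right; exact h9
  · left; omega
  · left; omega

/-- **FIRST LEMMA (the transfer, proved).** Kriz–Li Cor. 10.7 (2) + analytic continuation turn the
joint class-number supply `C⁺` into the crux on the sextic sub-corner. -/
theorem cruxOnSexticCorner_of_jointSupply
    (h107 : cor107_analyticRank_sexticTwist) (hmod : hasEntireLFunction_rat)
    (hJ : JointSupplyP3) : CruxOnSexticCorner := by
  intro W _ _ p _ _ d hKL hpd _hCM _hr1 hp5 hin _hbad hsup
  obtain ⟨K, iF, iN, hK, hd4, hHN, hH3, hhp, h3pos, h3neg⟩ := hJ W p d hKL hp5 hpd hin hsup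
  obtain ⟨hW, hfund, hcase, hfixpos, hfixneg⟩ := hKL
  have hr0 : (W.quadraticTwist (((NumberField.discr K : ℤ) : ℚ))).analyticRank = 0 :=
    ((h107 d W K hW hK hH3 hfund (mod3_of_case hcase)
      (fun hd ↦ ⟨hfixpos hd, h3pos hd⟩) (fun hd ↦ ⟨hfixneg hd, h3neg hd⟩)).2 hcase).2
  have hdK : ((NumberField.discr K : ℤ) : ℚ) ≠ 0 := by exact_mod_cast NumberField.discr_ne_zero K
  haveI : (W.quadraticTwist (((NumberField.discr K : ℤ) : ℚ))).IsElliptic :=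
    isElliptic_quadraticTwist (W := W) hdK
  have hL : (W.quadraticTwist (((NumberField.discr K : ℤ) : ℚ))).entireLFunction 1 ≠ 0 :=
    (analyticRank_eq_zero_iff_holds (W := W.quadraticTwist (((NumberField.discr K : ℤ) : ℚ)))
      (hmod _)).mp hr0
  exact ⟨K, iF, iN, hK, hd4, hHN, hL, hhp⟩

open scoped Classical in
/-- The DENSITY FORM that implies `C⁺` (informal pointer, typed as a bare lower-density statement
over the Heegner discriminants of `N`; the Davenport–Heilbronn/Nakagawa–Horie half — relative
density `≥ 1/2` of `3 ∤ h(ℚ(√(d₀ D)))` in every admissible progression — is Kriz–Li Thm. 9.4, typed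
in existence form as `KrizLi2019.thm94_exists_heegnerField_h3_eq_one`): "more than half of the
Heegner discriminants `D` of `N` have `p ∤ h(D)`". Stated here only to NAME the residual ladder
`crux|sextic ⟸ C⁺ ⟸ LowerDensityGtHalf`; it is Cohen–Lenstra-strength and open. -/
def LowerDensityGtHalf (N p : ℕ) : Prop :=
  ∃ η : ℝ, 1 / 2 < η ∧ ∃ X₀ : ℕ, ∀ X : ℕ, X₀ ≤ X →
    η * (((Finset.Icc 5 X).filter fun D : ℕ ↦
            Squarefree D ∧ D % 4 = 3 ∧ ∀ q : ℕ, q.Prime → q ∣ N → jacobiSym (-(D : ℤ)) q = 1).card : ℝ)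
      ≤ (((Finset.Icc 5 X).filter fun D : ℕ ↦
            Squarefree D ∧ D % 4 = 3 ∧ (∀ q : ℕ, q.Prime → q ∣ N → jacobiSym (-(D : ℤ)) q = 1) ∧
              ¬ p ∣ Literature.NumberTheory.QuadraticFields.BinaryQuadraticForm.classNumber (-(D : ℤ))).card : ℝ)

end Summit.BirchSwinnertonDyer.BirchSwinnertonDyer.Cruxes.HeegnerTwistCouplingInSupply.SexticSwitch
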